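import Mathlib
import HarnessLib

/-!
# `x ^ n + 2 ^ k y ^ n = p z ^ 2` for an odd prime `p` and astronomically large prime exponents (Zhang 2012)

Topic `Literature/NumberTheory/DiophantineGeometry` (shelf of `GeneralizedFermatSignatureNN2.lean` = Bennett–Skinner 2004,
whose Theorem 1.2 `bennettSkinner2004_sumWithTwoPowerEqCSquare` treats the same equation `xⁿ + 2^α yⁿ = C z²` for the
eight printed pairs `(C, α₀)`, and of `GeneralizedFermatNN2TwoPowerOddCoefficient.lean` = Bennett–Mulholland 2006 /
Dąbrowski 2010, where the power of `2` sits with the coefficient of `z²` instead).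

Content: the NAMED FACT `zhang2012_sumWithTwoPowerEqPrimeSquare` = the main theorem of Zhang Zhongfeng, *On the Diophantine
equation `xⁿ + 2ᵏyⁿ = pz²`* (Chinese), Sci. Sinica Math. 42 (2012), no. 10, 1047–1052 [ZhangZhongfeng2012]. The primary is
NOT held (in Chinese, behind the publisher's handshake; acquisition request acq-10227 of the venture cell `pub-abcsig`), so —
exactly as for `bennettMulholland2006_twoP` on the neighbouring shelf — the statement is vendored in the WEAKEST COMMON FORM of
its two available printed restatements, both quoted verbatim in the docstring: the author's summary (zbMATH Zbl 1488.11087)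
and A. Ratcliffe, B. Grechuk, *Generalised Fermat equation: a survey of solved cases*, Expo. Math. 43 (2025) 125688 =
arXiv:2412.11933 [RatcliffeGrechuk2024], Theorem 4.43 (held, p. 18 of the arXiv text). The two agree on everything except the
range of the exponent of `2` (`k ≥ 2` in the summary; `α ≥ 0, α ≠ 1` in the survey): the fact below keeps `2 ≤ k`, so
nothing here is stronger than either source. `-- TODO(general form)`: admit `k = 0` if the primary does.

Around it, PROVED here (elementary, no source needed beyond the survey's one-line deduction):
* `zhang2012Admissible p` — Zhang's hypothesis on the prime, "`p ≠ (2^m ± 1)/d²` for any integers `m` and `d`", as the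
  `Prop` "`p·d² ∉ {2^m + 1, 2^m − 1}` for all `m : ℕ`, `d : ℤ`, `d ≠ 0`";
* `zhang2012Admissible_of_mod_eight` — every `p > 5` with `p ≡ ±3 (mod 8)` is admissible (for `m ≥ 3`, `2^m ± 1 ≡ ±1
  (mod 8)` while `p d² ≡ p (mod 8)`, `d` being odd; `m ≤ 2` gives `2^m ± 1 ≤ 5 < p ≤ p d²`), which is the content of the
  deduction "From Theorem 4.43, Zhang deduces the following. Corollary 4.44" in the survey;
* `zhang2012_sumWithTwoPowerEqPrimeSquare.corollary` — Corollary 4.44 as printed (`α ≥ 2`, prime `s > 5`,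
  `s ≡ ±3 (mod 8)`, prime `p > s^{8s²}`), PROVED from the named fact and the lemma;
* `not_zhang2012Admissible_of_eq` and the witnesses `3 = 2¹ + 1`, `5 = 2² + 1`, `7 = 2³ − 1`, `17 = 2⁴ + 1`,
  `31 = 2⁵ − 1`, `41·5² = 2¹⁰ + 1`, `127 = 2⁷ − 1`: these primes are OUTSIDE the theorem (so it says nothing about
  Bennett–Skinner's `C ∈ {5, 7, 17}`), and the admissible examples `11, 13, 19, 29, 37, 43, 53, 59, 61, 67` (all `≡ ±3 mod 8`).

Why vendored (venture cell `pub-abcsig`, 2026-08-23): the cell's certified all-exponent rows for `xⁿ + 2^a yⁿ = C z²` with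
prime `19 ≤ C ≤ 59` outside Bennett–Skinner's list are classed SHARPENINGS of exactly this theorem (explicit `n ≥ 11` in place
of `n > C^{8C²}`); their class cells cite "[Zhang 2012]" — via the Corollary (no admissibility proviso) for
`C ∈ {13, 19, 29, 37, 43, 53, 59}`, via the Theorem with the proviso for `C ∈ {23, 47}` (`≡ 7 mod 8`, where admissibility is the
open-ended question `2^m − 1 ≠ C d²`, checked by the cell for `m ≤ 3·10⁴` only), and not at all for `C = 31 = 2⁵ − 1`,
`41 = (2¹⁰ + 1)/5²` (cell record `lit/FRESHNESS.md` §F-C1b-EXT). Vocabulary: plain integers, pairwise coprimality as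
`IsCoprime` (as in the Bennett–Skinner facts), prime exponent `n : ℕ`.

What is deliberately NOT here: the survey's `α = 0` clause (one source only); Zhang–Luo 2014 (`x^p + 2^α y^p = 3z²`, one
secondary sentence only); Mulholland's thesis theorem (RG24 Thm 4.29; unread, one restatement); any modular-method vocabulary.
No discharge is attempted (the proof in print is the modular method at level `2C²`/`C²`-type levels plus Kraus-type bounds).
-/

namespace Literature.NumberTheory.DiophantineGeometry

/-- **Zhang's admissibility hypothesis** on the (prime) coefficient `p` [ZhangZhongfeng2012, main theorem, hypothesis]:
"`p ≠ (2^m ± 1)/d²` for any integers `m` and `d`" (author's summary, zbMATH Zbl 1488.11087; Ratcliffe–Grechuk 2025,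
Thm 4.43: "For any integers `k, d`, `s ≠ (2^k ± 1)/d²`"), rendered without division: for every `m : ℕ` and every nonzero
`d : ℤ`, `p·d² ≠ 2^m + 1` and `p·d² ≠ 2^m − 1` (`m < 0` would not give an integer; `d = 0` is meaningless in the printed
quotient and is excluded). It fails exactly for the primes carrying a "pseudo-solution" `(∓1)ⁿ + 2^m·1 = p·d²` of the
equation with `|xy| = 1`, e.g. `3, 5, 7, 17, 31, 41, 127` (`not_zhang2012Admissible_examples`).
[cite: ZhangZhongfeng2012, main theorem (hypothesis), as restated in RatcliffeGrechuk2024 Thm 4.43] -/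
def zhang2012Admissible (p : ℕ) : Prop :=
  ∀ m : ℕ, ∀ d : ℤ, d ≠ 0 → (p : ℤ) * d ^ 2 ≠ 2 ^ m + 1 ∧ (p : ℤ) * d ^ 2 ≠ 2 ^ m - 1

/-- **Zhang 2012, main theorem** (Sci. Sinica Math. 42 (2012) 1047–1052; primary in Chinese, not held), in the WEAKEST
COMMON FORM of its two printed restatements. Author's summary (zbMATH Zbl 1488.11087, verbatim): "we show that if `p` is
an odd prime and `p ≠ (2^m ± 1)/d²` for any integers `m` and `d`, then the equation `xⁿ + 2ᵏyⁿ = pz², k ⩾ 2` has no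
solutions in nonzero pairwise coprime integers `x, y, z` and prime `n` with `n > p^{8p²}`." Ratcliffe–Grechuk, Expo. Math.
43 (2025) 125688, Thm 4.43 (verbatim): "Let `s, p` be odd primes. For any integers `k, d`, `s ≠ (2^k ± 1)/d²` and `α ≥ 0`,
`α ≠ 1`. If `p > s^{8s²}`, then the equation `x^p + 2^α y^p = sz²` has no integer solutions in pairwise coprime integers
`x, y, z` with `xyz ≠ 0`." Rendering: odd prime coefficient `p` (here `p : ℕ`, `p.Prime`, `p ≠ 2`) satisfying
`zhang2012Admissible p`; prime exponent `n` with `p^{8p²} < n` (so `n` is odd, as both sources have it); exponent of two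
`2 ≤ k` (the summary's range — the survey's extra case `α = 0` is NOT vendored, one source only); `x, y, z` nonzero and
pairwise coprime (`IsCoprime`); conclusion `xⁿ + 2ᵏ yⁿ ≠ p z²`. Nothing is stronger than either restatement.
-- TODO(general form): include `k = 0` (the survey's `α ≥ 0, α ≠ 1`) once the primary (acq-10227) is read.
[cite: ZhangZhongfeng2012, main theorem, as restated in RatcliffeGrechuk2024 Thm 4.43 and zbMATH Zbl 1488.11087] -/
def zhang2012_sumWithTwoPowerEqPrimeSquare : Prop :=
  ∀ p : ℕ, p.Prime → p ≠ 2 → zhang2012Admissible p →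
    ∀ n : ℕ, n.Prime → p ^ (8 * p ^ 2) < n → ∀ k : ℕ, 2 ≤ k →
    ∀ x y z : ℤ, x ≠ 0 → y ≠ 0 → z ≠ 0 → IsCoprime x y → IsCoprime x z → IsCoprime y z →
      x ^ n + 2 ^ k * y ^ n ≠ (p : ℤ) * z ^ 2

/-- A prime (indeed any natural number) `p > 5` with `p ≡ 3` or `p ≡ 5 (mod 8)` satisfies Zhang's hypothesis: if
`p d² = 2^m ± 1` then `m ≥ 1` and `d` is odd, so `p d² ≡ p ≡ ±3 (mod 8)`, whereas `2^m ± 1 ≡ ±1 (mod 8)` for `m ≥ 3`;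
and `m ≤ 2` gives `2^m ± 1 ≤ 5 < p ≤ p d²`. This is the deduction "From Theorem 4.43, Zhang deduces the following"
of Ratcliffe–Grechuk 2025 before Cor. 4.44. [cite: RatcliffeGrechuk2024, Cor 4.44 (deduction from Thm 4.43)] -/
theorem zhang2012Admissible_of_mod_eight {p : ℕ} (hp : 5 < p) (h8 : p % 8 = 3 ∨ p % 8 = 5) :
    zhang2012Admissible p := by
  intro m d hd
  have hd1 : (1 : ℤ) ≤ d ^ 2 := by
    have : d ≤ -1 ∨ 1 ≤ d := by omega
    rcases this with h | h <;> nlinarith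
  have hpd : (6 : ℤ) ≤ (p : ℤ) * d ^ 2 := by
    have : (6 : ℤ) ≤ (p : ℤ) := by exact_mod_cast hp
    nlinarith
  by_cases hm : m < 3
  · interval_cases m <;> constructor <;> intro h <;> rw [h] at hpd <;> norm_num at hpd
  · rw [not_lt] at hm
    have h2 : (2 : ZMod 8) ^ m = 0 := by
      obtain ⟨j, rfl⟩ : ∃ j, m = 3 + j := ⟨m - 3, by omega⟩
      rw [pow_add, show (2 : ZMod 8) ^ 3 = 0 from by decide, zero_mul]
    have hp8 : (p : ZMod 8) = 3 ∨ (p : ZMod 8) = 5 := by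
      rcases h8 with h | h
      · left; rw [← ZMod.natCast_mod, h]; rfl
      · right; rw [← ZMod.natCast_mod, h]; rfl
    have key : ∀ a b : ZMod 8, (a = 3 ∨ a = 5) → a * b ^ 2 ≠ 0 + 1 ∧ a * b ^ 2 ≠ 0 - 1 := by decide
    obtain ⟨k1, k2⟩ := key (p : ZMod 8) (d : ZMod 8) hp8
    constructor
    · intro h
      apply k1
      have hc := congrArg (fun t : ℤ => (t : ZMod 8)) h
      push_cast at hc
      rwa [h2] at hc
    · intro h
      apply k2
      have hc := congrArg (fun t : ℤ => (t : ZMod 8)) h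
      push_cast at hc
      rwa [h2] at hc

/-- **Zhang 2012, Corollary** = Ratcliffe–Grechuk 2025, Cor. 4.44 (verbatim): "Let `s, p` be odd primes. For any integers
`α ≥ 2` and `s > 5` satisfying `s ≡ ±3` modulo `8`. If `p > s^{8s²}`, then the equation `x^p + 2^α y^p = sz²` has no
integer solutions in pairwise coprime integers `x, y, z` with `xyz ≠ 0`." PROVED from the named fact: by
`zhang2012Admissible_of_mod_eight` the hypothesis `s ≠ (2^m ± 1)/d²` is automatic for such `s`. (This is the clause the
venture cell cites for prime `C ∈ {13, 19, 29, 37, 43, 53, 59}`.)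
[cite: ZhangZhongfeng2012, Corollary, as restated in RatcliffeGrechuk2024 Cor 4.44] -/
theorem zhang2012_sumWithTwoPowerEqPrimeSquare.corollary (h : zhang2012_sumWithTwoPowerEqPrimeSquare)
    {s : ℕ} (hs : s.Prime) (hs5 : 5 < s) (h8 : s % 8 = 3 ∨ s % 8 = 5)
    {n : ℕ} (hn : n.Prime) (hbound : s ^ (8 * s ^ 2) < n) {k : ℕ} (hk : 2 ≤ k)
    {x y z : ℤ} (hx : x ≠ 0) (hy : y ≠ 0) (hz : z ≠ 0)
    (hxy : IsCoprime x y) (hxz : IsCoprime x z) (hyz : IsCoprime y z) :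
    x ^ n + 2 ^ k * y ^ n ≠ (s : ℤ) * z ^ 2 :=
  h s hs (by omega) (zhang2012Admissible_of_mod_eight hs5 h8) n hn hbound k hk x y z hx hy hz hxy hxz hyz

/-- A single identity `p·d² = 2^m ± 1` with `d ≠ 0` refutes Zhang's hypothesis for `p`.
[cite: ZhangZhongfeng2012, main theorem (hypothesis)] -/
theorem not_zhang2012Admissible_of_eq {p m : ℕ} {d : ℤ} (hd : d ≠ 0)
    (h : (p : ℤ) * d ^ 2 = 2 ^ m + 1 ∨ (p : ℤ) * d ^ 2 = 2 ^ m - 1) : ¬ zhang2012Admissible p := by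
  intro hA
  obtain ⟨h1, h2⟩ := hA m d hd
  rcases h with h | h
  · exact h1 h
  · exact h2 h

/-- The primes `3 = 2¹ + 1`, `5 = 2² + 1`, `7 = 2³ − 1`, `17 = 2⁴ + 1`, `31 = 2⁵ − 1`, `41 = (2¹⁰ + 1)/5²` and
`127 = 2⁷ − 1` are NOT admissible: Zhang's theorem is silent about `xⁿ + 2ᵏ yⁿ = C z²` for `C ∈ {3, 5, 7, 17, 31, 41, 127}`
(in particular about Bennett–Skinner's `C ∈ {5, 7, 17}` and the venture cell's `C ∈ {31, 41}`).
[cite: ZhangZhongfeng2012, main theorem (hypothesis); RatcliffeGrechuk2024 Thm 4.43] -/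
theorem not_zhang2012Admissible_examples :
    ¬ zhang2012Admissible 3 ∧ ¬ zhang2012Admissible 5 ∧ ¬ zhang2012Admissible 7 ∧ ¬ zhang2012Admissible 17 ∧
    ¬ zhang2012Admissible 31 ∧ ¬ zhang2012Admissible 41 ∧ ¬ zhang2012Admissible 127 := by
  refine ⟨?_, ?_, ?_, ?_, ?_, ?_, ?_⟩
  · exact not_zhang2012Admissible_of_eq (m := 1) (d := 1) one_ne_zero (Or.inl (by norm_num))
  · exact not_zhang2012Admissible_of_eq (m := 2) (d := 1) one_ne_zero (Or.inl (by norm_num))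
  · exact not_zhang2012Admissible_of_eq (m := 3) (d := 1) one_ne_zero (Or.inr (by norm_num))
  · exact not_zhang2012Admissible_of_eq (m := 4) (d := 1) one_ne_zero (Or.inl (by norm_num))
  · exact not_zhang2012Admissible_of_eq (m := 5) (d := 1) one_ne_zero (Or.inr (by norm_num))
  · exact not_zhang2012Admissible_of_eq (m := 10) (d := 5) (by norm_num) (Or.inl (by norm_num))
  · exact not_zhang2012Admissible_of_eq (m := 7) (d := 1) one_ne_zero (Or.inr (by norm_num))

/-- The primes `11, 13, 19, 29, 37, 43, 53, 59, 61, 67` (all `> 5` and `≡ ±3 (mod 8)`) ARE admissible, by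
`zhang2012Admissible_of_mod_eight`; so the Corollary applies verbatim to `xⁿ + 2ᵏ yⁿ = C z²` for these `C`
(the venture cell's prime coefficients `13, 19, 29, 37, 43, 53, 59`; for `23, 47 ≡ 7 (mod 8)` admissibility is NOT
decided by this congruence). [cite: RatcliffeGrechuk2024, Cor 4.44] -/
theorem zhang2012Admissible_examples :
    zhang2012Admissible 11 ∧ zhang2012Admissible 13 ∧ zhang2012Admissible 19 ∧ zhang2012Admissible 29 ∧
    zhang2012Admissible 37 ∧ zhang2012Admissible 43 ∧ zhang2012Admissible 53 ∧ zhang2012Admissible 59 ∧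
    zhang2012Admissible 61 ∧ zhang2012Admissible 67 :=
  ⟨zhang2012Admissible_of_mod_eight (by norm_num) (by norm_num),
   zhang2012Admissible_of_mod_eight (by norm_num) (by norm_num),
   zhang2012Admissible_of_mod_eight (by norm_num) (by norm_num),
   zhang2012Admissible_of_mod_eight (by norm_num) (by norm_num),
   zhang2012Admissible_of_mod_eight (by norm_num) (by norm_num),
   zhang2012Admissible_of_mod_eight (by norm_num) (by norm_num),
   zhang2012Admissible_of_mod_eight (by norm_num) (by norm_num),
   zhang2012Admissible_of_mod_eight (by norm_num) (by norm_num),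
   zhang2012Admissible_of_mod_eight (by norm_num) (by norm_num),
   zhang2012Admissible_of_mod_eight (by norm_num) (by norm_num)⟩


/-!
## Zhang's hypothesis for primes `s ≡ 23 (mod 24)` — in particular `s = 23, 47`

Appended 2026-08-23 (lit seat g4). The survey's Corollary 4.44 settles Zhang's proviso `s ≠ (2^m ± 1)/d²` for
`s ≡ ±3 (mod 8)`; the two remaining prime coefficients of the venture cell's rows, `23` and `47` (`≡ 7 mod 8`), are
settled here by an equally elementary argument (mod `8`, mod `3`, and the factorisation `2^{2t} − 1 = (2^t − 1)(2^t + 1)`).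
Helpers are private: `2^t − 1` is never a square for `t ≥ 2`; `2^t + 1` is a square only for `t = 3`; `2^t ∓ 1` are
coprime.
-/

/-- `2 ^ t - 1` is not a square for `t ≥ 2` (it is `≡ 3 (mod 4)`). [folklore] -/
private theorem two_pow_sub_one_ne_sq {t : ℕ} (ht : 2 ≤ t) (a : ℤ) : (2 : ℤ) ^ t - 1 ≠ a ^ 2 := by
  intro h
  have h4 : (2 : ZMod 4) ^ t = 0 := by
    obtain ⟨j, rfl⟩ : ∃ j, t = 2 + j := ⟨t - 2, by omega⟩
    rw [pow_add, show (2 : ZMod 4) ^ 2 = 0 from by decide, zero_mul]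
  have key : ∀ b : ZMod 4, (0 : ZMod 4) - 1 ≠ b ^ 2 := by decide
  apply key (a : ZMod 4)
  have hc := congrArg (fun z : ℤ => (z : ZMod 4)) h
  push_cast at hc
  rwa [h4] at hc

/-- If `2 ^ t + 1` is a square then `t = 3`: writing the root as `k + 1`, `k (k + 2) = 2 ^ t`, so `k` and
`k + 2` are powers of two differing by `2`, i.e. `(2, 4)`. [folklore] -/
private theorem eq_three_of_two_pow_add_one_eq_sq {t : ℕ} {a : ℤ} (h : (2 : ℤ) ^ t + 1 = a ^ 2) :
    t = 3 := by
  -- pass to a natural root n = |a|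
  have hn' : (2 : ℕ) ^ t + 1 = a.natAbs ^ 2 := by
    have h2 : (((2 : ℕ) ^ t + 1 : ℕ) : ℤ) = ((a.natAbs ^ 2 : ℕ) : ℤ) := by push_cast; rw [sq_abs]; exact h
    exact_mod_cast h2
  obtain ⟨n, hn⟩ : ∃ n : ℕ, (2 : ℕ) ^ t + 1 = n ^ 2 := ⟨_, hn'⟩
  have hpos : 0 < 2 ^ t := Nat.two_pow_pos t
  -- n ≥ 2, write n = k + 1 with k ≥ 1
  obtain ⟨k, rfl⟩ : ∃ k, n = k + 1 := ⟨n - 1, by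
    have : n ≠ 0 := by rintro h0; rw [h0] at hn; omega
    omega⟩
  have hk : k * (k + 2) = 2 ^ t := by nlinarith [hn]
  have hk1 : 1 ≤ k := by
    rcases Nat.eq_zero_or_pos k with rfl | hk0
    · simp at hk; omega
    · exact hk0
  -- k and k + 2 are powers of two
  obtain ⟨i, -, hi⟩ := (Nat.dvd_prime_pow Nat.prime_two).mp (Dvd.intro _ hk)
  obtain ⟨j, -, hj⟩ := (Nat.dvd_prime_pow Nat.prime_two).mp (Dvd.intro_left _ hk)
  -- case analysis on k
  by_cases hk3 : 3 ≤ k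
  · -- then i ≥ 2 and j ≥ 2, so 4 ∣ k and 4 ∣ k + 2: impossible
    have hi2 : 2 ≤ i := by
      by_contra hlt
      interval_cases i <;> simp at hi <;> omega
    have hj2 : 2 ≤ j := by
      by_contra hlt
      interval_cases j <;> simp at hj
      omega
    have h4k : 4 ∣ k := by rw [hi]; exact (pow_dvd_pow 2 hi2 : 2 ^ 2 ∣ 2 ^ i)
    have h4k2 : 4 ∣ k + 2 := by rw [hj]; exact (pow_dvd_pow 2 hj2 : 2 ^ 2 ∣ 2 ^ j)
    omega
  · interval_cases k
    · -- k = 1: 3 = 2^t impossible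
      exfalso
      have h3 : (3 : ℕ) = 2 ^ t := by simpa using hk
      rcases Nat.eq_zero_or_pos t with rfl | ht
      · simp at h3
      · have : 2 ∣ 2 ^ t := dvd_pow_self 2 ht.ne'
        rw [← h3] at this
        omega
    · -- k = 2: 8 = 2^t
      have h8 : 2 ^ t = 2 ^ 3 := by simpa using hk.symm
      exact Nat.pow_right_injective (le_refl 2) h8

/-- `2 ^ t - 1` and `2 ^ t + 1` are coprime in `ℤ` (for `t ≥ 1`; explicit Bézout relation). [folklore] -/
private theorem isCoprime_two_pow_sub_one_add_one {t : ℕ} (ht : 1 ≤ t) :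
    IsCoprime ((2 : ℤ) ^ t - 1) ((2 : ℤ) ^ t + 1) := by
  obtain ⟨r, rfl⟩ : ∃ r, t = r + 1 := ⟨t - 1, by omega⟩
  refine ⟨-(2 ^ r + 1), 2 ^ r, ?_⟩
  rw [pow_succ]
  ring

/-- A prime `s ≡ 23 (mod 24)` (i.e. `s ≡ 7 (mod 8)` and `s ≡ 2 (mod 3)`: `23, 47, 71, 167, 191, 239, 263, 311, …`)
satisfies Zhang's hypothesis. ELEMENTARY, supplied here (the survey's Cor. 4.44 covers only `s ≡ ±3 (mod 8)`; for
`s ≡ 7 (mod 8)` the venture cell had only a finite search): (A) `s d² = 2^m + 1` is impossible mod `8` for `m ≥ 3`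
(`d` odd, `s d² ≡ 7`, `2^m + 1 ≡ 1`) and by size for `m ≤ 2`; (B) `s d² = 2^m − 1` is impossible mod `3` for odd `m`
(`2^m − 1 ≡ 1`, `s d² ≡ 2d² ∈ {0, 2}`), and for even `m = 2t ≥ 4` the coprime factorisation
`(2^t − 1)(2^t + 1) = s d²` with `s` prime forces `2^t − 1` or `2^t + 1` to be a square, whence `t ≤ 1` or `t = 3`,
i.e. `s ∣ 3` or `s ∣ 7` — absurd for `s ≥ 23`. Consequence for the venture cell `pub-abcsig`: Zhang's theorem applies
UNCONDITIONALLY to `xⁿ + 2ᵏ yⁿ = 23 z²` and `= 47 z²` (`zhang2012Admissible_twentythree_fortyseven`), so together with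
`zhang2012Admissible_examples` / `not_zhang2012Admissible_examples` the hypothesis is decided for every odd prime
`C ≤ 59`. [cite: ZhangZhongfeng2012, main theorem (hypothesis), elementary verification for s ≡ 23 mod 24; cf. RatcliffeGrechuk2024 Cor 4.44] -/
theorem zhang2012Admissible_of_prime_mod_twentyfour {s : ℕ} (hs : s.Prime) (h24 : s % 24 = 23) :
    zhang2012Admissible s := by
  intro m d hd
  have hd1 : (1 : ℤ) ≤ d ^ 2 := by
    have : d ≤ -1 ∨ 1 ≤ d := by omega
    rcases this with h | h <;> nlinarith
  have hs23 : (23 : ℤ) ≤ (s : ℤ) := by exact_mod_cast (show 23 ≤ s by omega)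
  have hsd : (23 : ℤ) ≤ (s : ℤ) * d ^ 2 := by nlinarith
  have hs0 : (s : ℤ) ≠ 0 := by positivity
  constructor
  · -- (A) s d² ≠ 2^m + 1
    intro h
    by_cases hm : m < 3
    · interval_cases m <;> norm_num at h <;> omega
    · rw [not_lt] at hm
      have h8 : (2 : ZMod 8) ^ m = 0 := by
        obtain ⟨j, rfl⟩ : ∃ j, m = 3 + j := ⟨m - 3, by omega⟩
        rw [pow_add, show (2 : ZMod 8) ^ 3 = 0 from by decide, zero_mul]
      have hs8 : (s : ZMod 8) = 7 := by
        rw [← ZMod.natCast_mod, show s % 8 = 7 by omega]; rfl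
      have key : ∀ b : ZMod 8, (7 : ZMod 8) * b ^ 2 ≠ 0 + 1 := by decide
      apply key (d : ZMod 8)
      have hc := congrArg (fun z : ℤ => (z : ZMod 8)) h
      push_cast at hc
      rwa [h8, hs8] at hc
  · -- (B) s d² ≠ 2^m − 1
    intro h
    rcases Nat.even_or_odd m with ⟨t, rfl⟩ | hodd
    · -- m = t + t even
      by_cases ht : t < 2
      · interval_cases t <;> norm_num at h <;> omega
      · rw [not_lt] at ht
        have hfac : (s : ℤ) * d ^ 2 = (2 ^ t - 1) * (2 ^ t + 1) := by rw [h, pow_add]; ring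
        have hsp : Prime (s : ℤ) := Nat.prime_iff_prime_int.mp hs
        have hcop : IsCoprime ((2 : ℤ) ^ t - 1) ((2 : ℤ) ^ t + 1) :=
          isCoprime_two_pow_sub_one_add_one (by omega)
        have hdvd : (s : ℤ) ∣ (2 ^ t - 1) * (2 ^ t + 1) := ⟨d ^ 2, hfac.symm⟩
        have h2t : (0 : ℤ) < 2 ^ t := by positivity
        rcases hsp.dvd_or_dvd hdvd with ⟨w, hw⟩ | ⟨w, hw⟩
        · -- (B2) s ∣ 2^t − 1: then 2^t + 1 is a square ⇒ t = 3 ⇒ s ∣ 7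
          have hsq : (2 ^ t + 1) * w = d ^ 2 := by
            apply mul_left_cancel₀ hs0
            rw [hfac, hw]; ring
          have hcop' : IsCoprime ((2 : ℤ) ^ t + 1) w := by
            rw [hw] at hcop
            exact (hcop.symm).of_mul_right_right
          obtain ⟨a, ha | ha⟩ := Int.sq_of_isCoprime hcop' hsq
          · have ht3 := eq_three_of_two_pow_add_one_eq_sq ha
            subst ht3
            norm_num at hw
            -- hw : 7 = s * w  ⇒ s ∣ 7 ⇒ s ≤ 7
            have : (s : ℤ) ∣ 7 := ⟨w, hw⟩
            have := Int.le_of_dvd (by norm_num) this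
            omega
          · nlinarith [sq_nonneg a]
        · -- (B1) s ∣ 2^t + 1: then 2^t − 1 is a square ⇒ impossible for t ≥ 2
          have hsq : (2 ^ t - 1) * w = d ^ 2 := by
            apply mul_left_cancel₀ hs0
            rw [hfac, hw]; ring
          have hcop' : IsCoprime ((2 : ℤ) ^ t - 1) w := by
            rw [hw] at hcop
            exact hcop.of_mul_right_right
          obtain ⟨a, ha | ha⟩ := Int.sq_of_isCoprime hcop' hsq
          · exact two_pow_sub_one_ne_sq ht a ha
          · nlinarith [sq_nonneg a]
    · -- m odd: mod 3
      obtain ⟨k, rfl⟩ := hodd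
      have h3 : (2 : ZMod 3) ^ (2 * k + 1) = 2 := by
        rw [pow_succ, pow_mul, show (2 : ZMod 3) ^ 2 = 1 from by decide, one_pow, one_mul]
      have hs3 : (s : ZMod 3) = 2 := by
        rw [← ZMod.natCast_mod, show s % 3 = 2 by omega]; rfl
      have key : ∀ b : ZMod 3, (2 : ZMod 3) * b ^ 2 ≠ 2 - 1 := by decide
      apply key (d : ZMod 3)
      have hc := congrArg (fun z : ℤ => (z : ZMod 3)) h
      push_cast at hc
      rwa [h3, hs3] at hc

/-- `23` and `47` satisfy Zhang's hypothesis (both are primes `≡ 23 (mod 24)`), so [ZhangZhongfeng2012]'s theorem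
(`zhang2012_sumWithTwoPowerEqPrimeSquare`) applies to `xⁿ + 2ᵏ yⁿ = 23 z²` and `xⁿ + 2ᵏ yⁿ = 47 z²` without proviso.
[cite: ZhangZhongfeng2012, main theorem (hypothesis), cases s = 23, 47; RatcliffeGrechuk2024 Thm 4.43] -/
theorem zhang2012Admissible_twentythree_fortyseven : zhang2012Admissible 23 ∧ zhang2012Admissible 47 :=
  ⟨zhang2012Admissible_of_prime_mod_twentyfour (by norm_num) (by norm_num),
   zhang2012Admissible_of_prime_mod_twentyfour (by norm_num) (by norm_num)⟩


/-!
## Sharpness of Zhang's proviso: the pseudo-solutions `(±1)ⁿ + 2^m · 1ⁿ = p · d²`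

Appended 2026-08-23 (lit seat g4). If `p d² = 2^m + 1` then `(x, y, z) = (1, 1, d)` solves `xⁿ + 2^m yⁿ = p z²` for EVERY `n`;
if `p d² = 2^m − 1` then `(−1, 1, d)` solves it for every ODD `n`. Both triples are nonzero and pairwise coprime, so the
conclusion of `zhang2012_sumWithTwoPowerEqPrimeSquare` genuinely fails at `k = m` for a non-admissible prime: the proviso
"`p ≠ (2^m ± 1)/d²`" cannot be dropped. These are the `|xy| = 1` "pseudo-solutions" behind Bennett–Skinner's thresholds
`α₀` in Theorem 1.2 (`1 + 2² = 5`, `−1 + 2³ = 7`, `−1 + 2⁴ = 15`, `1 + 2⁴ = 17`) and behind the venture cell's parked cells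
(`1 + 2¹⁰ = 41·5²`, `1 + 2⁹ = 57·3²`). Elementary; recorded here so that the rôle of the hypothesis is kernel-checked next to
the fact.
-/

/-- The two pseudo-solution identities: `p d² = 2^m + 1 ⇒ 1ⁿ + 2^m·1ⁿ = p d²` (all `n`) and
`p d² = 2^m − 1 ⇒ (−1)ⁿ + 2^m·1ⁿ = p d²` (odd `n`). With `two_pow_pseudoSolution_isCoprime` this shows that the conclusion
of [ZhangZhongfeng2012]'s theorem fails at `k = m` whenever its proviso fails (e.g. `p ∈ {3, 5, 7, 17, 31, 41, 127}`,
`not_zhang2012Admissible_examples`). [cite: ZhangZhongfeng2012, main theorem (hypothesis) — sharpness; cf. BennettSkinner2004 Thm 1.2 (thresholds α₀)] -/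
theorem zhang2012_pseudoSolutions {p m : ℕ} {d : ℤ} :
    ((p : ℤ) * d ^ 2 = 2 ^ m + 1 → ∀ n : ℕ, (1 : ℤ) ^ n + 2 ^ m * 1 ^ n = p * d ^ 2) ∧
    ((p : ℤ) * d ^ 2 = 2 ^ m - 1 → ∀ n : ℕ, Odd n → (-1 : ℤ) ^ n + 2 ^ m * 1 ^ n = p * d ^ 2) := by
  refine ⟨fun h n => ?_, fun h n hn => ?_⟩
  · simp only [one_pow, mul_one]
    linarith
  · rw [hn.neg_one_pow]
    simp only [one_pow, mul_one]
    linarith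

/-- The pseudo-solution triples `(1, 1, d)` and `(−1, 1, d)` are pairwise coprime (and nonzero when `d ≠ 0`), i.e. they
are admissible solutions in the sense of `zhang2012_sumWithTwoPowerEqPrimeSquare`. [folklore] -/
private theorem two_pow_pseudoSolution_isCoprime (d : ℤ) :
    IsCoprime (1 : ℤ) 1 ∧ IsCoprime (1 : ℤ) d ∧ IsCoprime (-1 : ℤ) 1 ∧ IsCoprime (-1 : ℤ) d :=
  ⟨isCoprime_one_left, isCoprime_one_left, isCoprime_one_right, isCoprime_one_left.neg_left⟩

/-- Consequently the statement of Zhang's theorem WITHOUT the proviso is false: for `p = 5` (`5·1² = 2² + 1`, `k = 2`)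
the triple `(1, 1, 1)` is a nonzero pairwise coprime solution of `xⁿ + 2²yⁿ = 5z²` for every `n`, and for `p = 7`
(`7·1² = 2³ − 1`, `k = 3`) the triple `(−1, 1, 1)` solves `xⁿ + 2³yⁿ = 7z²` for every odd `n` — in particular for
primes `n > p^{8p²}`. [cite: ZhangZhongfeng2012, main theorem (hypothesis) — sharpness at p = 5, 7] -/
theorem zhang2012_proviso_needed :
    (∀ n : ℕ, (1 : ℤ) ^ n + 2 ^ 2 * 1 ^ n = 5 * 1 ^ 2) ∧
    (∀ n : ℕ, Odd n → (-1 : ℤ) ^ n + 2 ^ 3 * 1 ^ n = 7 * 1 ^ 2) ∧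
    IsCoprime (1 : ℤ) 1 ∧ IsCoprime (-1 : ℤ) 1 := by
  refine ⟨fun n => ?_, fun n hn => ?_, isCoprime_one_left, isCoprime_one_right⟩
  · simp
  · rw [hn.neg_one_pow]
    norm_num

end Literature.NumberTheory.DiophantineGeometry
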